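import Summits.KontsevichZagierPeriods.Zeta5Search.Barrier.ConeGammaBreakpoints
import Summits.KontsevichZagierPeriods.Zeta5Search.Barrier.ConeGammaRecordRate
import Summits.KontsevichZagierPeriods.Zeta5Search.Barrier.ConeGammaFlag
import Summits.KontsevichZagierPeriods.Zeta5Search.Barrier.ConeGammaRidge
import Literature.NumberTheory.DiophantineApproximation.PrimeFractionalPartClassesCutoff

/-!
# ζ(5) search — BARRIER: the `Φ_n` half of `DenominatorRate` is a THEOREM — `(1/n) log Φ_n(a) → Φ(a)`

HONEST FRAMING (cell `pub-zeta5`): systematic search; no irrationality claim unless kernel-certified. MODEL objects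
under Brown–Zudilin's (28)+(30) accounting ([BZ22] = arXiv:2210.03391); nothing here is a statement about `ζ(5)`;
records in print UNMOVED. Item (w3) of the theory seat's list (`BARRIER-PLAN.md` §7; cert-2 g17, WAKE w3 of lead/lit
g23). `ConeGammaAccounting` names the ANALYTIC identification `DenominatorRate a`:
`(1/n) log (D_n(a)/Φ_n(a)) → δ₂₈(a) − Φ(a)`, and proves its `D_n` half (`tendsto_log_D28_div`, the prime number
theorem). This file proves the **`Φ_n` half**: for every integer parameter vector `a` of the closed box,

  `tendsto_log_PhiN_div : (1/n) log Φ_n(a) → Φ(a) = phi30 (realDir a)`,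

where `Φ_n(a) = ∏_{√(m₁n) < p ≤ m₁n} p^{N_a(n/p)}` (`PhiN`). Proof: `N_a` has period `1` (`savingN_realDir_add_one`),
so `N_a(n/p) = N_a({n/p})`; on one period `N_a` is a step function with breakpoint data `(b_m, c_m)`
(`exists_breakpoint_data`), so `log Φ_n = Σ_m c_m Σ_{p : {n/p} ∈ [b_m,b_{m+1})} log p` (`log_PhiNH_eq_sum_classSum`, stated for a general cut `H ≥` every form, `PhiNH`; `PhiN = PhiNH a m₁`) is a combination of
Rhin–Viola CLASS PRIME sums, each of rate `Σ_k (1/(k+b_m) − 1/(k+b_{m+1}))`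
(`RhinViola.tendsto_sum_log_prime_fract_div_cutoff`, the prime number theorem with fractional-part classes; the
classes with `b_m < 1/m₁` carry `c_m = 0`), and the exact period formula `phi30_eq_sum_tsum` identifies the limit
with `Φ(a)`. Consequence `denominatorRate_of_delta28_eq`: `DenominatorRate a` holds as soon as the bookkeeping
identity `δ₂₈(a) = m₁ + ⋯ + m₅` (sum of the five largest forms = the max over 5-subsets) is supplied — for the
record / flag-60 / N1-ridge rays both sides are the tree's `84` / `123` / `955`, so **`denominatorRate_recordVec`**, **`denominatorRate_flagVec`**, **`denominatorRate_ridgeVec`** are unconditional.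
Not here (honest): `δ₂₈ = Σ_{k<5} m_k` in general (a sorting identity), `RatesIdentified` (Poincaré–Perron) and
`Law28/Law30` — the remaining hypotheses of `exponent_of_accounting`.
-/

noncomputable section

open Set MeasureTheory Filter
open scoped Topology

namespace Summit.KontsevichZagierPeriods.Zeta5Search.Barrier.ConeGamma

open Literature.NumberTheory.Irrationality.BrownZudilin2022 (hList hForm recordVec)
open Summit.KontsevichZagierPeriods.Zeta5Search.FlagFamily (flagVec flagVec_data)
open Summit.KontsevichZagierPeriods.Zeta5Search.RidgeFamily (ridgeVec ridgeVec_data)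

/-! ### `m₁ = mIdx a 0` dominates every form -/

/-- Every entry of the multiset `h(a)` is at most its sorted maximum `m₁ = mIdx a 0`. -/
theorem le_mIdx_zero_of_mem {a : Fin 8 → ℤ} {x : ℤ} (hx : x ∈ hList a) : x ≤ mIdx a 0 := by
  unfold mIdx
  have hsorted : (((hList a).insertionSort (· ≤ ·)).reverse).Pairwise (fun u v => v ≤ u) := by
    rw [List.pairwise_reverse]
    exact List.pairwise_insertionSort (· ≤ ·) (hList a)
  have hmem : x ∈ ((hList a).insertionSort (· ≤ ·)).reverse := by
    rw [List.mem_reverse]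
    exact (List.perm_insertionSort (· ≤ ·) (hList a)).symm.subset hx
  revert hsorted hmem
  generalize ((hList a).insertionSort (· ≤ ·)).reverse = L
  intro hsorted hmem
  match L, hsorted, hmem with
  | [], _, h => simp at h
  | m :: rest, hs, h =>
    simp only [List.getD_cons_zero]
    rcases List.mem_cons.mp h with h' | h'
    · rw [h']
    · exact (List.pairwise_cons.mp hs).1 x h'

/-- `h_{k+1}(a)` is an entry of the list `h(a)`. -/
theorem hForm_mem_hList (a : Fin 8 → ℤ) (k : Fin 28) : hForm a (k + 1) ∈ hList a := by
  unfold hForm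
  have hlen : (hList a).length = 28 := rfl
  have hk : (k : ℕ) + 1 - 1 < (hList a).length := by rw [hlen]; simp
  rw [List.getD_eq_getElem _ _ hk]
  exact List.getElem_mem _

/-- **Every form is at most `m₁`** (as reals, with `m₁` read as the natural number used in `PhiN`). -/
theorem h28_realDir_le_m1 (a : Fin 8 → ℤ) (k : Fin 28) : h28 (realDir a) k ≤ ((mIdx a 0).toNat : ℝ) := by
  rw [h28_realDir]
  have h1 : hForm a (k + 1) ≤ mIdx a 0 := le_mIdx_zero_of_mem (hForm_mem_hList a k)
  have h2 : mIdx a 0 ≤ ((mIdx a 0).toNat : ℤ) := Int.self_le_toNat _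
  exact_mod_cast h1.trans h2

/-- `2s₀ = h₂ + h₃ + h₄` (`= a₂ + a₃ + a₄`). -/
theorem two_mul_s0_eq (A : Dir) : 2 * sParam A 0 = h28 A 1 + h28 A 2 + h28 A 3 := by
  simp [sParam, h28]
  ring

/-- On the box a bound `H` of the forms is positive. -/
theorem cut_pos {a : Fin 8 → ℤ} (ha : BZBox (realDir a)) {H : ℕ} (hH : ∀ k, h28 (realDir a) k ≤ H) : 0 < H := by
  have h0 : 0 < sParam (realDir a) 0 := ha.1
  have hs := two_mul_s0_eq (realDir a)
  have hle := add_le_add (add_le_add (hH 1) (hH 2)) (hH 3)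
  have hpos : (0 : ℝ) < (H : ℝ) := by linarith
  exact_mod_cast hpos

/-- On the box `m₁ > 0`. -/
theorem m1_pos {a : Fin 8 → ℤ} (ha : BZBox (realDir a)) : 0 < (mIdx a 0).toNat :=
  cut_pos ha (h28_realDir_le_m1 a)

/-- **`N_a(u) = 0` for `0 ≤ u < 1/H`** whenever `H` bounds the forms (every floor `⌊h_k u⌋` vanishes). -/
theorem savingN_realDir_eq_zero {a : Fin 8 → ℤ} (ha : BZBox (realDir a)) {H : ℕ} (hH : ∀ k, h28 (realDir a) k ≤ H)
    {u : ℝ} (hu0 : 0 ≤ u) (hu : u * H < 1) : savingN (realDir a) u = 0 := by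
  rw [← savingN_eq_zero_of_small ha le_rfl (by simp)]
  refine savingN_congr_floor fun k => ?_
  rw [mul_zero, Int.floor_zero, Int.floor_eq_zero_iff]
  refine ⟨mul_nonneg (h28_nonneg_of_BZBox ha k) hu0, ?_⟩
  calc h28 (realDir a) k * u ≤ H * u := mul_le_mul_of_nonneg_right (hH k) hu0
    _ < 1 := by rwa [mul_comm]

/-- Period `1` of an integer parameter vector, read through the fractional part: `N_a(x) = N_a({x})` (`x ≥ 0`). -/
theorem savingN_realDir_eq_fract {a : Fin 8 → ℤ} (ha : BZBox (realDir a)) {x : ℝ} (hx : 0 ≤ x) :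
    savingN (realDir a) x = savingN (realDir a) (Int.fract x) := by
  have hper : ∀ k : Fin 28, ∃ z : ℤ, (1 : ℝ) * h28 (realDir a) k = z :=
    fun k => ⟨hForm a (k + 1), by rw [one_mul, h28_realDir]⟩
  have h := savingN_add_nat_mul_period ha hper (Int.fract x) ⌊x⌋₊
  rw [mul_one, natCast_floor_eq_intCast_floor hx, Int.fract_add_floor] at h
  exact h

/-! ### Partition bookkeeping -/

/-- A point of `[b₀, b_M)` lies in one of the cells `[b_m, b_{m+1})`. -/
theorem exists_mem_Ico_cell {b : ℕ → ℝ} {M : ℕ} {x : ℝ} (hx : x ∈ Set.Ico (b 0) (b M)) :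
    ∃ m < M, x ∈ Set.Ico (b m) (b (m + 1)) := by
  induction M with
  | zero => exact absurd hx.2 (not_lt.mpr hx.1)
  | succ M ih =>
    by_cases h : x < b M
    · obtain ⟨m, hm, hmx⟩ := ih ⟨hx.1, h⟩
      exact ⟨m, by omega, hmx⟩
    · exact ⟨M, by omega, not_lt.mp h, hx.2⟩

/-- Breakpoints with strict steps are monotone. -/
theorem cell_mono {b : ℕ → ℝ} {M : ℕ} (hb : ∀ m < M, b m < b (m + 1)) {m m' : ℕ} (hmm' : m ≤ m') (hm' : m' ≤ M) :
    b m ≤ b m' := by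
  induction m' with
  | zero => rw [Nat.le_zero.mp hmm']
  | succ m' ih =>
    rcases Nat.lt_or_eq_of_le hmm' with h | h
    · exact (ih (by omega) (by omega)).trans (hb m' (by omega)).le
    · rw [h]

/-- The cells are disjoint: membership determines the index. -/
theorem cell_unique {b : ℕ → ℝ} {M : ℕ} (hb : ∀ m < M, b m < b (m + 1)) {m m' : ℕ} (hm : m < M) (hm' : m' < M)
    {x : ℝ} (hx : x ∈ Set.Ico (b m) (b (m + 1))) (hx' : x ∈ Set.Ico (b m') (b (m' + 1))) : m = m' := by
  by_contra hne
  rcases lt_or_gt_of_ne hne with h | h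
  · have := cell_mono hb (Nat.succ_le_of_lt h) hm'.le
    linarith [hx.2, hx'.1]
  · have := cell_mono hb (Nat.succ_le_of_lt h) hm.le
    linarith [hx'.2, hx.1]

/-- **The saving as a sum over cells**: for `x ∈ [b₀, b_M)`,
`N(x) = Σ_{m<M} [x ∈ [b_m, b_{m+1})]·c_m`. -/
theorem savingN_eq_sum_cells {A : Dir} {M : ℕ} {b : ℕ → ℝ} {c : ℕ → ℤ} (hb : ∀ m < M, b m < b (m + 1))
    (hc : ∀ m < M, ∀ u ∈ Set.Ico (b m) (b (m + 1)), savingN A u = c m) {x : ℝ}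
    (hx : x ∈ Set.Ico (b 0) (b M)) :
    (savingN A x : ℝ) = ∑ m ∈ Finset.range M, if x ∈ Set.Ico (b m) (b (m + 1)) then (c m : ℝ) else 0 := by
  obtain ⟨m₀, hm₀, hx₀⟩ := exists_mem_Ico_cell hx
  rw [Finset.sum_eq_single m₀, if_pos hx₀, hc m₀ hm₀ x hx₀]
  · intro m hm hne
    rw [if_neg]
    intro hxm
    exact hne (cell_unique hb (Finset.mem_range.mp hm) hm₀ hxm hx₀)
  · intro h; exact absurd (Finset.mem_range.mpr hm₀) h

/-! ### `Φ_n` with a general cut, and `log Φ_n` as a combination of class prime sums -/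

/-- `Φ_n` with a general threshold/cut `H` in place of `m₁` (`PhiN a = PhiNH a m₁`, `PhiN_eq_PhiNH`). -/
def PhiNH (a : Fin 8 → ℤ) (H n : ℕ) : ℕ :=
  ∏ p ∈ (Finset.range (H * n + 1)).filter (fun p => p.Prime ∧ H * n < p * p),
    p ^ (savingN (realDir a) ((n : ℝ) / p)).toNat

/-- `Φ_n = Φ_n^{(m₁)}`. -/
theorem PhiN_eq_PhiNH (a : Fin 8 → ℤ) (n : ℕ) : PhiN a n = PhiNH a (mIdx a 0).toNat n := rfl

/-- The Rhin–Viola class prime sum that appears: primes `p ≤ Hn`, `p² > Hn`, `u ≤ {n/p} < v`. -/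
def classSum (H : ℕ) (u v : ℝ) (n : ℕ) : ℝ :=
  ∑ p ∈ (Finset.range (H * n + 1)).filter (fun p : ℕ => p.Prime ∧
      (H : ℝ) * n < ((p : ℝ)) ^ 2 ∧ u ≤ Int.fract ((n : ℝ) / p) ∧ Int.fract ((n : ℝ) / p) < v),
    Real.log p

/-- `log Φ_n^{(H)} = Σ_p N_a(n/p) log p`. -/
theorem log_PhiNH (a : Fin 8 → ℤ) (H n : ℕ) : Real.log (PhiNH a H n) =
    ∑ p ∈ (Finset.range (H * n + 1)).filter (fun p => p.Prime ∧ H * n < p * p),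
      (((savingN (realDir a) ((n : ℝ) / p)).toNat : ℕ) : ℝ) * Real.log p := by
  unfold PhiNH
  push_cast
  rw [Real.log_prod]
  · refine Finset.sum_congr rfl fun p _ => ?_
    rw [Real.log_pow]
  · intro p hp
    have hp' : p.Prime := (Finset.mem_filter.mp hp).2.1
    exact pow_ne_zero _ (by exact_mod_cast hp'.ne_zero)

/-- **`log Φ_n^{(H)}(a) = Σ_{m<M} c_m · classSum H b_m b_{m+1} n`** for breakpoint data `(b, c)` of the period
`[0,1)`. -/
theorem log_PhiNH_eq_sum_classSum {a : Fin 8 → ℤ} (ha : BZBox (realDir a)) (H : ℕ) {M : ℕ} {b : ℕ → ℝ}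
    {c : ℕ → ℤ} (hb0 : b 0 = 0) (hbM : b M = 1) (hb : ∀ m < M, b m < b (m + 1))
    (hc : ∀ m < M, ∀ u ∈ Set.Ico (b m) (b (m + 1)), savingN (realDir a) u = c m) (n : ℕ) :
    Real.log (PhiNH a H n) = ∑ m ∈ Finset.range M, (c m : ℝ) * classSum H (b m) (b (m + 1)) n := by
  classical
  rw [log_PhiNH]
  have hcell : ∀ p ∈ (Finset.range (H * n + 1)).filter (fun p => p.Prime ∧ H * n < p * p),
      (((savingN (realDir a) ((n : ℝ) / p)).toNat : ℕ) : ℝ) =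
        ∑ m ∈ Finset.range M, if Int.fract ((n : ℝ) / p) ∈ Set.Ico (b m) (b (m + 1)) then (c m : ℝ) else 0 := by
    intro p _
    have h0 := savingN_nonneg (realDir a) ((n : ℝ) / p)
    have hcast : (((savingN (realDir a) ((n : ℝ) / p)).toNat : ℕ) : ℝ) = (savingN (realDir a) ((n : ℝ) / p) : ℝ) := by
      have h1 : (((savingN (realDir a) ((n : ℝ) / p)).toNat : ℕ) : ℤ) = savingN (realDir a) ((n : ℝ) / p) :=
        Int.toNat_of_nonneg h0
      exact_mod_cast h1
    rw [hcast, savingN_realDir_eq_fract ha (x := (n : ℝ) / p) (div_nonneg (Nat.cast_nonneg _) (Nat.cast_nonneg _))]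
    refine savingN_eq_sum_cells hb hc ?_
    rw [hb0, hbM]
    exact ⟨Int.fract_nonneg _, Int.fract_lt_one _⟩
  rw [Finset.sum_congr rfl fun p hp => by rw [hcell p hp]]
  simp_rw [Finset.sum_mul, ite_mul, zero_mul]
  rw [Finset.sum_comm]
  refine Finset.sum_congr rfl fun m _ => ?_
  rw [← Finset.sum_filter, Finset.filter_filter, classSum, Finset.mul_sum]
  refine Finset.sum_congr (Finset.filter_congr fun p _ => ?_) fun _ _ => rfl
  have key : (H * n < p * p) ↔ ((H : ℝ) * n < (p : ℝ) ^ 2) := by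
    rw [← Nat.cast_lt (α := ℝ)]; push_cast; rw [sq]
  simp only [Set.mem_Ico, key]
  tauto

/-- Classes that carry saving start at or beyond `1/H`: if `c_m ≠ 0` then `1/H ≤ b_m`. -/
theorem inv_cut_le_of_ne_zero {a : Fin 8 → ℤ} (ha : BZBox (realDir a)) {H : ℕ} (hH : ∀ k, h28 (realDir a) k ≤ H)
    {M : ℕ} {b : ℕ → ℝ} {c : ℕ → ℤ} (hb0 : b 0 = 0) (hb : ∀ m < M, b m < b (m + 1))
    (hc : ∀ m < M, ∀ u ∈ Set.Ico (b m) (b (m + 1)), savingN (realDir a) u = c m) {m : ℕ} (hm : m < M)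
    (hcm : c m ≠ 0) : 1 / (H : ℝ) ≤ b m := by
  by_contra hlt
  push Not at hlt
  have hbm0 : 0 ≤ b m := by rw [← hb0]; exact cell_mono hb (Nat.zero_le m) hm.le
  have hH0 : (0 : ℝ) < (H : ℝ) := by exact_mod_cast cut_pos ha hH
  have h0 := savingN_realDir_eq_zero ha hH hbm0 (by rwa [lt_div_iff₀ hH0] at hlt)
  exact hcm (by rw [← hc m hm (b m) ⟨le_rfl, hb m hm⟩, h0])

/-! ### The rate -/

/-- The rate for a general cut `H` bounding the forms. -/
theorem tendsto_log_PhiNH_div {a : Fin 8 → ℤ} (ha : BZBox (realDir a)) {H : ℕ} (hH : ∀ k, h28 (realDir a) k ≤ H) :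
    Tendsto (fun n : ℕ => Real.log (PhiNH a H n) / n) atTop (𝓝 (phi30 (realDir a))) := by
  obtain ⟨M, b, c, hb0, hbM, hb, hc⟩ := exists_breakpoint_data ha one_pos
  have hper : ∀ k : Fin 28, ∃ z : ℤ, (1 : ℝ) * h28 (realDir a) k = z :=
    fun k => ⟨hForm a (k + 1), by rw [one_mul, h28_realDir]⟩
  have hHpos : (0 : ℝ) < (H : ℝ) := by exact_mod_cast cut_pos ha hH
  -- the limit, class by class
  have hclass : ∀ m ∈ Finset.range M,
      Tendsto (fun n : ℕ => (c m : ℝ) * (classSum H (b m) (b (m + 1)) n / n)) atTop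
        (𝓝 ((c m : ℝ) * ∑' k : ℕ, (1 / ((k : ℝ) + b m) - 1 / ((k : ℝ) + b (m + 1))))) := by
    intro m hm
    rw [Finset.mem_range] at hm
    by_cases hcm : c m = 0
    · simp only [hcm, Int.cast_zero, zero_mul]
      exact tendsto_const_nhds
    · refine Tendsto.const_mul _ ?_
      have hbm : 1 / (H : ℝ) ≤ b m := inv_cut_le_of_ne_zero ha hH hb0 hb hc hm hcm
      have hu : 0 < b m := lt_of_lt_of_le (by positivity) hbm
      have hv : b (m + 1) ≤ 1 := by rw [← hbM]; exact cell_mono hb (Nat.succ_le_of_lt hm) le_rfl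
      have h1 : (1 : ℝ) ≤ (H : ℝ) * b m := by
        have := (div_le_iff₀ hHpos).mp hbm; linarith
      have hN : ∀ n : ℕ, (n : ℝ) / b m ≤ ((H * n : ℕ) : ℝ) := by
        intro n
        rw [div_le_iff₀ hu, Nat.cast_mul]
        have hn : (0 : ℝ) ≤ n := Nat.cast_nonneg n
        nlinarith
      exact Literature.NumberTheory.DiophantineApproximation.RhinViola.tendsto_sum_log_prime_fract_div_cutoff
        hu (hb m hm) hv (fun n => H * n) hN hHpos.le
  have hsum := tendsto_finsetSum (Finset.range M) hclass
  -- identify the limit with `Φ(a)` through the exact period formula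
  have hΦ : phi30 (realDir a) =
      ∑ m ∈ Finset.range M, (c m : ℝ) * ∑' k : ℕ, (1 / ((k : ℝ) + b m) - 1 / ((k : ℝ) + b (m + 1))) := by
    rw [phi30_eq_sum_tsum ha one_pos hper hb0 hbM (fun m hm => (hb m hm).le)
      (fun m hm u hu => hc m hm u (Set.Ioo_subset_Ico_self hu))]
    simp only [mul_one]
  rw [hΦ]
  refine hsum.congr fun n => ?_
  rw [log_PhiNH_eq_sum_classSum ha H hb0 hbM hb hc n, Finset.sum_div]
  refine Finset.sum_congr rfl fun m _ => ?_
  ring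

/-- **THE `Φ_n` HALF OF `DenominatorRate` (w3)**: for every integer parameter vector of the closed box,
`(1/n) log Φ_n(a) → Φ(a)`. -/
theorem tendsto_log_PhiN_div {a : Fin 8 → ℤ} (ha : BZBox (realDir a)) :
    Tendsto (fun n : ℕ => Real.log (PhiN a n) / n) atTop (𝓝 (phi30 (realDir a))) :=
  tendsto_log_PhiNH_div ha (h28_realDir_le_m1 a)

/-- **`DenominatorRate` from the bookkeeping identity**: if `δ₂₈(a) = m₁ + ⋯ + m₅` (sum of the five largest forms,
as naturals), then `(1/n) log (D_n/Φ_n) → δ₂₈ − Φ`. -/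
theorem denominatorRate_of_delta28_eq {a : Fin 8 → ℤ} (ha : BZBox (realDir a))
    (hδ : delta28 (realDir a) = ∑ k : Fin 5, ((mIdx a k).toNat : ℝ)) : DenominatorRate a := by
  unfold DenominatorRate
  have h1 := tendsto_log_D28_div a
  have h2 := tendsto_log_PhiN_div ha
  rw [hδ]
  refine ((h1.sub h2).congr fun n => ?_)
  rw [Real.log_div (by exact_mod_cast (D28_pos a n).ne') (by exact_mod_cast (PhiN_pos a n).ne'), sub_div]

/-- **`DenominatorRate` holds for BZ's record ray** `(8,16,10,15,12,16,18,13)` unconditionally: `δ₂₈ = 84 =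
18 + 17 + 17 + 16 + 16` (tree: `delta28_recordDir`, `mIdx_recordVec`). -/
theorem denominatorRate_recordVec : DenominatorRate recordVec := by
  have hbox : BZBox (realDir recordVec) := recordDir_mem_BZCone.1
  refine denominatorRate_of_delta28_eq hbox ?_
  obtain ⟨h0, h1, h2, h3, h4⟩ := mIdx_recordVec
  have hδ : delta28 (realDir recordVec) = 84 := delta28_recordDir
  rw [hδ, Fin.sum_univ_five]
  have e0 : ((0 : Fin 5) : ℕ) = 0 := rfl
  have e1 : ((1 : Fin 5) : ℕ) = 1 := rfl
  have e2 : ((2 : Fin 5) : ℕ) = 2 := rfl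
  have e3 : ((3 : Fin 5) : ℕ) = 3 := rfl
  have e4 : ((4 : Fin 5) : ℕ) = 4 := rfl
  rw [e0, e1, e2, e3, e4, h0, h1, h2, h3, h4, show (18 : ℤ).toNat = 18 from rfl, show (17 : ℤ).toNat = 17 from rfl,
    show (16 : ℤ).toNat = 16 from rfl]
  norm_num

/-- The FLAG-60 ray's five maxima `(26,25,25,24,23)` (sum `123 = δ₂₈(flag)`), read off `flagVec_data`. -/
theorem mIdx_flagVec :
    mIdx flagVec 0 = 26 ∧ mIdx flagVec 1 = 25 ∧ mIdx flagVec 2 = 25 ∧ mIdx flagVec 3 = 24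
      ∧ mIdx flagVec 4 = 23 := by
  unfold mIdx
  rw [flagVec_data.2.2.2]
  simp

/-- The N1-argmax RIDGE ray's five maxima `(207,196,190,184,178)` (sum `955 = δ₂₈(ridge)`), read off
`ridgeVec_data`. -/
theorem mIdx_ridgeVec :
    mIdx ridgeVec 0 = 207 ∧ mIdx ridgeVec 1 = 196 ∧ mIdx ridgeVec 2 = 190 ∧ mIdx ridgeVec 3 = 184
      ∧ mIdx ridgeVec 4 = 178 := by
  unfold mIdx
  rw [ridgeVec_data.2.2.2]
  simp

/-- Bookkeeping for the three pinned rays: `Σ_{k<5} m_k` as a real number from the five values. -/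
theorem sum_mIdx_five (a : Fin 8 → ℤ) {m0 m1 m2 m3 m4 : ℕ} (h0 : mIdx a 0 = m0) (h1 : mIdx a 1 = m1)
    (h2 : mIdx a 2 = m2) (h3 : mIdx a 3 = m3) (h4 : mIdx a 4 = m4) :
    ∑ k : Fin 5, ((mIdx a k).toNat : ℝ) = (m0 : ℝ) + m1 + m2 + m3 + m4 := by
  rw [Fin.sum_univ_five]
  have e0 : ((0 : Fin 5) : ℕ) = 0 := rfl
  have e1 : ((1 : Fin 5) : ℕ) = 1 := rfl
  have e2 : ((2 : Fin 5) : ℕ) = 2 := rfl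
  have e3 : ((3 : Fin 5) : ℕ) = 3 := rfl
  have e4 : ((4 : Fin 5) : ℕ) = 4 := rfl
  rw [e0, e1, e2, e3, e4, h0, h1, h2, h3, h4]
  simp only [Int.toNat_natCast]

/-- **`DenominatorRate` holds for the FLAG-60 ray** `(11,24,14,22,17,23,26,19)` unconditionally
(`δ₂₈ = 123 = 26+25+25+24+23`; tree: `FlagRay.delta28_flagDir`). -/
theorem denominatorRate_flagVec : DenominatorRate flagVec := by
  have hbox : BZBox (realDir flagVec) := FlagRay.flagDir_mem_BZCone.1
  refine denominatorRate_of_delta28_eq hbox ?_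
  obtain ⟨h0, h1, h2, h3, h4⟩ := mIdx_flagVec
  have hδ : delta28 (realDir flagVec) = 123 := FlagRay.delta28_flagDir
  rw [hδ, sum_mIdx_five flagVec (m0 := 26) (m1 := 25) (m2 := 25) (m3 := 24) (m4 := 23)
    (by exact_mod_cast h0) (by exact_mod_cast h1) (by exact_mod_cast h2) (by exact_mod_cast h3)
    (by exact_mod_cast h4)]
  norm_num

/-- **`DenominatorRate` holds for the N1-argmax RIDGE ray** `(89,184,124,172,142,178,196,154)` unconditionally
(`δ₂₈ = 955 = 207+196+190+184+178`; tree: `RidgeRay.delta28_ridgeDir`). MODEL object; the direction is the lane's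
FLOAT ARGMAX, not a census flag. -/
theorem denominatorRate_ridgeVec : DenominatorRate ridgeVec := by
  have hbox : BZBox (realDir ridgeVec) := RidgeRay.ridgeDir_mem_BZCone.1
  refine denominatorRate_of_delta28_eq hbox ?_
  obtain ⟨h0, h1, h2, h3, h4⟩ := mIdx_ridgeVec
  have hδ : delta28 (realDir ridgeVec) = 955 := RidgeRay.delta28_ridgeDir
  rw [hδ, sum_mIdx_five ridgeVec (m0 := 207) (m1 := 196) (m2 := 190) (m3 := 184) (m4 := 178)
    (by exact_mod_cast h0) (by exact_mod_cast h1) (by exact_mod_cast h2) (by exact_mod_cast h3)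
    (by exact_mod_cast h4)]
  norm_num

end Summit.KontsevichZagierPeriods.Zeta5Search.Barrier.ConeGamma

end
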